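import Mathlib
import HarnessLib
import Summits.HubbardSuperconductivity.HubbardSuperconductivity.Theorems.KLProgrammeKLRegimeEnginePlainLineFromMomentumRepresentation

/-!
# Route `KLProgramme` — engine support (row (X).1 / #14 «S3 IN U-CURRENCY», NORM side, brick (T6)): the momentum↔position dictionary for EVERY balanced
# charge string — creators on legs `τ 0, τ 1`, annihilators on legs `τ 2, τ 3` for a permutation `τ` of the four legs

Cell gate-hubbard-kl, seat hubbard-kl-k3c2-p3 (g16).  (T5b)/(T7) treat the charge string `(+,+,−,−)`; the plain-line import row quantifies over ALL spin/charge
strings `((0,s),c')`.  For a balanced string `c = (+,+,−,−) ∘ τ⁻¹` (creators on legs `τ 0, τ 1`) a conserving transfer-only kernel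
`K k = κ·[k̄_{τ0} + k̄_{τ1} = k̄_{τ2} + k̄_{τ3}]·f(k̄_{τ0} + k̄_{τ1})` has plane-wave transform
  `Σ_k (∏_i e^{∓ik_i·x_i})·K k = conj u(x_{τ0})·conj u(x_{τ1})·u(x_{τ2})·u(x_{τ3})·κ·[x_{τ1} = x_{τ0}][x_{τ3} = x_{τ2}]·(2M·L²)²·Σ_Q χ̄_Q(x̄_{τ0} − x̄_{τ2})·f(−Q)`
(reindex the momentum tuple by `τ`, then (T7) `planeWaveSum_eq_pairTransfer_of_conserving` at the permuted points) — i.e. a pair-transfer form in the pairing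
`{τ0,τ1}{τ2,τ3}`; relative to the pinned leg `0` this is one of the three pairings of (T2′) (`…PlainFromValuesPairings`), up to the symbol flip `Q ↦ −Q`
when leg `0` is an annihilator.

* **`planeWaveSum_eq_pairTransfer_of_conserving_perm`**, **`norm_planeWaveSum_le_pairTransfer_of_conserving_perm`** — the general permuted identity and its norm form;
* `…_swap12` (string `(+,−,+,−)`, pairing `{0,2}{1,3}` = (T2′) form ₂ VERBATIM), `…_cycle132` (string `(+,−,−,+)`, pairing `{0,3}{1,2}` = form ₃ VERBATIM).

Everything is proved; no definitions, no named facts; nothing asserted for any engine object; nothing asserts (X).1, (b), K3 or superconductivity. [folklore]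
References: BGM 2006 §2.1, §2.3 (2.17), §3 (3.2)–(3.6) [cite: BenfattoGiulianiMastropietro2006].
-/

noncomputable section

namespace Summit.HubbardSuperconductivity.HubbardSuperconductivity.Theorems.TorusFourierL2

set_option linter.dupNamespace false -- summit = problem name (single-conjunct summit), D-0017

open Finset Complex Literature.Probability.LatticeModels Literature.MathematicalPhysics.QuantumLattice
open Literature.MathematicalPhysics.QuantumLattice.GrassmannAlgebra
open Summit.HubbardSuperconductivity.HubbardSuperconductivity.Theorems.KLRegimeSplit
open scoped Real ComplexConjugate

variable {L M : ℕ} [NeZero L] [NeZero M]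

/-- **The permuted dictionary**: creators on legs `τ 0, τ 1`, annihilators on legs `τ 2, τ 3` (see the module docstring).
[cite: BenfattoGiulianiMastropietro2006, §2.3 (2.17)] -/
theorem planeWaveSum_eq_pairTransfer_of_conserving_perm {β : ℝ} (hβ : β ≠ 0) (σ : Fin 4 → Fin 2) (τ : Equiv.Perm (Fin 4))
    (c : Fin 4 → Fin 2) (hc : ∀ j : Fin 4, c (τ j) = (![0, 0, 1, 1] : Fin 4 → Fin 2) j)
    (K : (Fin 4 → FreqMomentum L M) → ℂ) (κ : ℂ) (f : TorusSite 1 (2 * M) × TorusSite 2 L → ℂ)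
    (hker : ∀ k : Fin 4 → FreqMomentum L M, K k = κ * (if ((fun _ : Fin 1 => (((k (τ 0)).1 : ℕ) : ZMod (2 * M))), (k (τ 0)).2) + ((fun _ : Fin 1 => (((k (τ 1)).1 : ℕ) : ZMod (2 * M))), (k (τ 1)).2) = (((fun _ : Fin 1 => (((k (τ 2)).1 : ℕ) : ZMod (2 * M))), (k (τ 2)).2) : TorusSite 1 (2 * M) × TorusSite 2 L) + ((fun _ : Fin 1 => (((k (τ 3)).1 : ℕ) : ZMod (2 * M))), (k (τ 3)).2) then f (((fun _ : Fin 1 => (((k (τ 0)).1 : ℕ) : ZMod (2 * M))), (k (τ 0)).2) + ((fun _ : Fin 1 => (((k (τ 1)).1 : ℕ) : ZMod (2 * M))), (k (τ 1)).2)) else 0))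
    (x : Fin 4 → SpaceTimeIdx L M) :
    ∑ k : Fin 4 → FreqMomentum L M, (∏ i, trivialMultiplier L M ((fun i : Fin 4 => ((((0 : Fin 1), σ i) : Fin 1 × Fin 2), c i)) i).1.1 (k i) * hubbardPlaneWave L M β ((fun i : Fin 4 => ((((0 : Fin 1), σ i) : Fin 1 × Fin 2), c i)) i).2 (k i) (x i)) * K k =
      (conj (Complex.exp (((π * (1 - 2 * M) * (((x (τ 0)).1 : ℕ) : ℝ) / (2 * M) : ℝ) : ℂ) * I)) * conj (Complex.exp (((π * (1 - 2 * M) * (((x (τ 1)).1 : ℕ) : ℝ) / (2 * M) : ℝ) : ℂ) * I)) * Complex.exp (((π * (1 - 2 * M) * (((x (τ 2)).1 : ℕ) : ℝ) / (2 * M) : ℝ) : ℂ) * I) * Complex.exp (((π * (1 - 2 * M) * (((x (τ 3)).1 : ℕ) : ℝ) / (2 * M) : ℝ) : ℂ) * I) * κ) *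
        (if x (τ 1) = x (τ 0) ∧ x (τ 3) = x (τ 2) then ((((2 * M : ℕ) : ℂ) * (L : ℂ) ^ 2) ^ 2) *
          ∑ Q : TorusSite 1 (2 * M) × TorusSite 2 L, (torusChar (Q).1 ((((fun _ : Fin 1 => (((x (τ 0)).1 : ℕ) : ZMod (2 * M))), (x (τ 0)).2) : TorusSite 1 (2 * M) × TorusSite 2 L) - (((fun _ : Fin 1 => (((x (τ 2)).1 : ℕ) : ZMod (2 * M))), (x (τ 2)).2) : TorusSite 1 (2 * M) × TorusSite 2 L)).1 * torusChar (Q).2 ((((fun _ : Fin 1 => (((x (τ 0)).1 : ℕ) : ZMod (2 * M))), (x (τ 0)).2) : TorusSite 1 (2 * M) × TorusSite 2 L) - (((fun _ : Fin 1 => (((x (τ 2)).1 : ℕ) : ZMod (2 * M))), (x (τ 2)).2) : TorusSite 1 (2 * M) × TorusSite 2 L)).2) * f (-Q) else 0) := by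
  classical
  have ht : ∀ (ω : Fin 1) (q : FreqMomentum L M), trivialMultiplier L M ω q = 1 := fun _ _ => rfl
  -- reindex the momentum tuple by `τ`: `k ↦ k ∘ τ`
  have hre : ∑ k : Fin 4 → FreqMomentum L M, (∏ i, trivialMultiplier L M ((fun i : Fin 4 => ((((0 : Fin 1), σ i) : Fin 1 × Fin 2), c i)) i).1.1 (k i) * hubbardPlaneWave L M β ((fun i : Fin 4 => ((((0 : Fin 1), σ i) : Fin 1 × Fin 2), c i)) i).2 (k i) (x i)) * K k =
      ∑ k : Fin 4 → FreqMomentum L M, (∏ i, trivialMultiplier L M ((fun i : Fin 4 => ((((0 : Fin 1), σ (τ i)) : Fin 1 × Fin 2), (![0, 0, 1, 1] : Fin 4 → Fin 2) i)) i).1.1 (k i) * hubbardPlaneWave L M β ((fun i : Fin 4 => ((((0 : Fin 1), σ (τ i)) : Fin 1 × Fin 2), (![0, 0, 1, 1] : Fin 4 → Fin 2) i)) i).2 (k i) ((x ∘ τ) i)) * (κ * (if ((fun _ : Fin 1 => (((k 0).1 : ℕ) : ZMod (2 * M))), (k 0).2) + ((fun _ : Fin 1 => (((k 1).1 : ℕ)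 : ZMod (2 * M))), (k 1).2) = (((fun _ : Fin 1 => (((k 2).1 : ℕ) : ZMod (2 * M))), (k 2).2) : TorusSite 1 (2 * M) × TorusSite 2 L) + ((fun _ : Fin 1 => (((k 3).1 : ℕ) : ZMod (2 * M))), (k 3).2) then f (((fun _ : Fin 1 => (((k 0).1 : ℕ) : ZMod (2 * M))), (k 0).2) + ((fun _ : Fin 1 => (((k 1).1 : ℕ) : ZMod (2 * M))), (k 1).2)) else 0)) := by
    refine Fintype.sum_equiv (Equiv.arrowCongr τ.symm (Equiv.refl (FreqMomentum L M))) _ _ fun k => ?_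
    have hk : (Equiv.arrowCongr τ.symm (Equiv.refl (FreqMomentum L M))) k = k ∘ τ := by
      funext j; simp [Equiv.arrowCongr]
    rw [hk, hker k]
    congr 1
    -- the leg product, reindexed by `τ`
    refine (Fintype.prod_equiv τ (fun j => trivialMultiplier L M ((fun i : Fin 4 => ((((0 : Fin 1), σ (τ i)) : Fin 1 × Fin 2), (![0, 0, 1, 1] : Fin 4 → Fin 2) i)) j).1.1 ((k ∘ τ) j) *
        hubbardPlaneWave L M β ((fun i : Fin 4 => ((((0 : Fin 1), σ (τ i)) : Fin 1 × Fin 2), (![0, 0, 1, 1] : Fin 4 → Fin 2) i)) j).2 ((k ∘ τ) j) ((x ∘ τ) j))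
      (fun i => trivialMultiplier L M ((fun i : Fin 4 => ((((0 : Fin 1), σ i) : Fin 1 × Fin 2), c i)) i).1.1 (k i) * hubbardPlaneWave L M β ((fun i : Fin 4 => ((((0 : Fin 1), σ i) : Fin 1 × Fin 2), c i)) i).2 (k i) (x i)) fun j => ?_).symm
    simp only [ht, one_mul, Function.comp_apply]
    rw [hc j]
  rw [hre]
  exact planeWaveSum_eq_pairTransfer_of_conserving hβ (σ ∘ τ) (fun k => κ * (if ((fun _ : Fin 1 => (((k 0).1 : ℕ) : ZMod (2 * M))), (k 0).2) + ((fun _ : Fin 1 => (((k 1).1 : ℕ) : ZMod (2 * M))), (k 1).2) = (((fun _ : Fin 1 => (((k 2).1 : ℕ) : ZMod (2 * M))), (k 2).2) : TorusSite 1 (2 * M) × TorusSite 2 L) + ((fun _ : Fin 1 => (((k 3).1 : ℕ) : ZMod (2 * M))), (k 3).2) then f (((fun _ : Fin 1 => (((k 0).1 : ℕ) : ZMod (2 * M))), (k 0).2) + ((fun _ : Fin 1 => (((k 1).1 : ℕ) : ZMod (2 * M))), (k 1).2)) else 0)) κ f (fun k => rfl) (x ∘ τ)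

/-- Norm form of the permuted dictionary: `‖Σ_k (∏ e^{∓ik·x})·K k‖ ≤ [x_{τ1} = x_{τ0}][x_{τ3} = x_{τ2}]·(‖κ‖(2M·L²)²)·‖Σ_Q χ̄_Q(x̄_{τ0} − x̄_{τ2})•f(−Q)‖`.
[cite: BenfattoGiulianiMastropietro2006, §2.3 (2.17)] -/
theorem norm_planeWaveSum_le_pairTransfer_of_conserving_perm {β : ℝ} (hβ : β ≠ 0) (σ : Fin 4 → Fin 2) (τ : Equiv.Perm (Fin 4))
    (c : Fin 4 → Fin 2) (hc : ∀ j : Fin 4, c (τ j) = (![0, 0, 1, 1] : Fin 4 → Fin 2) j)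
    (K : (Fin 4 → FreqMomentum L M) → ℂ) (κ : ℂ) (f : TorusSite 1 (2 * M) × TorusSite 2 L → ℂ)
    (hker : ∀ k : Fin 4 → FreqMomentum L M, K k = κ * (if ((fun _ : Fin 1 => (((k (τ 0)).1 : ℕ) : ZMod (2 * M))), (k (τ 0)).2) + ((fun _ : Fin 1 => (((k (τ 1)).1 : ℕ) : ZMod (2 * M))), (k (τ 1)).2) = (((fun _ : Fin 1 => (((k (τ 2)).1 : ℕ) : ZMod (2 * M))), (k (τ 2)).2) : TorusSite 1 (2 * M) × TorusSite 2 L) + ((fun _ : Fin 1 => (((k (τ 3)).1 : ℕ) : ZMod (2 * M))), (k (τ 3)).2) then f (((fun _ : Fin 1 => (((k (τ 0)).1 : ℕ) : ZMod (2 * M))), (k (τ 0)).2) + ((fun _ : Fin 1 => (((k (τ 1)).1 : ℕ) : ZMod (2 * M))), (k (τ 1)).2)) else 0))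
    (x : Fin 4 → SpaceTimeIdx L M) :
    ‖∑ k : Fin 4 → FreqMomentum L M, (∏ i, trivialMultiplier L M ((fun i : Fin 4 => ((((0 : Fin 1), σ i) : Fin 1 × Fin 2), c i)) i).1.1 (k i) * hubbardPlaneWave L M β ((fun i : Fin 4 => ((((0 : Fin 1), σ i) : Fin 1 × Fin 2), c i)) i).2 (k i) (x i)) * K k‖ ≤
      if x (τ 1) = x (τ 0) ∧ x (τ 3) = x (τ 2) then (‖κ‖ * ((((2 * M : ℕ) : ℝ) * (L : ℝ) ^ 2) ^ 2)) * ‖∑ Q : TorusSite 1 (2 * M) × TorusSite 2 L,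
        (torusChar Q.1 (fun _ : Fin 1 => (((x (τ 0)).1 : ℕ) : ZMod (2 * M)) - (((x (τ 2)).1 : ℕ) : ZMod (2 * M))) *
          torusChar Q.2 ((x (τ 0)).2 - (x (τ 2)).2)) • (fun Q => f (-Q)) Q‖ else 0 := by
  rw [planeWaveSum_eq_pairTransfer_of_conserving_perm hβ σ τ c hc K κ f hker x]
  have hu : ∀ i : Fin 4, ‖Complex.exp (((π * (1 - 2 * M) * (((x i).1 : ℕ) : ℝ) / (2 * M) : ℝ) : ℂ) * I)‖ = 1 := fun i => Complex.norm_exp_ofReal_mul_I _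
  by_cases hx : x (τ 1) = x (τ 0) ∧ x (τ 3) = x (τ 2)
  · rw [if_pos hx, if_pos hx, norm_mul, norm_mul, norm_mul, norm_mul, norm_mul, norm_mul, Complex.norm_conj, Complex.norm_conj,
      hu (τ 0), hu (τ 1), hu (τ 2), hu (τ 3), norm_pow, norm_mul, Complex.norm_natCast, norm_pow, Complex.norm_natCast]
    refine le_of_eq ?_
    have hsub : ((((fun _ : Fin 1 => (((x (τ 0)).1 : ℕ) : ZMod (2 * M))), (x (τ 0)).2) : TorusSite 1 (2 * M) × TorusSite 2 L) - (((fun _ : Fin 1 => (((x (τ 2)).1 : ℕ) : ZMod (2 * M))), (x (τ 2)).2) : TorusSite 1 (2 * M) × TorusSite 2 L) : TorusSite 1 (2 * M) × TorusSite 2 L) = ((fun _ : Fin 1 => (((x (τ 0)).1 : ℕ) : ZMod (2 * M)) - (((x (τ 2)).1 : ℕ) : ZMod (2 * M))), (x (τ 0)).2 - (x (τ 2)).2) := rfl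
    rw [hsub]
    simp only [smul_eq_mul]
    ring
  · rw [if_neg hx, if_neg hx, mul_zero, norm_zero]

/-! ### Two named instances: the strings with leg `0` a creator -/

/-- **String `(+,−,+,−)`** (creators on legs `0,2`): conservation `k̄₀ + k̄₂ = k̄₁ + k̄₃`, transfer `f(k̄₀ + k̄₂)` ⟹ (T2′)'s pairing-`{0,2}{1,3}` majorant
`[x 2 = x 0 ∧ x 3 = x 1]·(‖κ‖(2M·L²)²)·‖Σ_Q χ̄_Q(x̄₀ − x̄₁)•f(−Q)‖`. [cite: BenfattoGiulianiMastropietro2006, §3 (3.2)–(3.6)] -/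
theorem norm_planeWaveSum_le_pairTransfer_of_conserving_swap12 {β : ℝ} (hβ : β ≠ 0) (σ : Fin 4 → Fin 2)
    (K : (Fin 4 → FreqMomentum L M) → ℂ) (κ : ℂ) (f : TorusSite 1 (2 * M) × TorusSite 2 L → ℂ)
    (hker : ∀ k : Fin 4 → FreqMomentum L M, K k = κ * (if ((fun _ : Fin 1 => (((k 0).1 : ℕ) : ZMod (2 * M))), (k 0).2) + ((fun _ : Fin 1 => (((k 2).1 : ℕ) : ZMod (2 * M))), (k 2).2) = (((fun _ : Fin 1 => (((k 1).1 : ℕ) : ZMod (2 * M))), (k 1).2) : TorusSite 1 (2 * M) × TorusSite 2 L) + ((fun _ : Fin 1 => (((k 3).1 : ℕ) : ZMod (2 * M))), (k 3).2) then f (((fun _ : Fin 1 => (((k 0).1 : ℕ) : ZMod (2 * M))), (k 0).2) + ((fun _ : Fin 1 => (((k 2).1 : ℕ) : ZMod (2 * M))), (k 2).2)) else 0))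
    (x : Fin 4 → SpaceTimeIdx L M) :
    ‖∑ k : Fin 4 → FreqMomentum L M,
        (∏ i, trivialMultiplier L M ((fun i : Fin 4 => ((((0 : Fin 1), σ i) : Fin 1 × Fin 2), (![0, 1, 0, 1] : Fin 4 → Fin 2) i)) i).1.1 (k i) *
          hubbardPlaneWave L M β ((fun i : Fin 4 => ((((0 : Fin 1), σ i) : Fin 1 × Fin 2), (![0, 1, 0, 1] : Fin 4 → Fin 2) i)) i).2 (k i) (x i)) * K k‖ ≤
      if x 2 = x 0 ∧ x 3 = x 1 then (‖κ‖ * ((((2 * M : ℕ) : ℝ) * (L : ℝ) ^ 2) ^ 2)) * ‖∑ Q : TorusSite 1 (2 * M) × TorusSite 2 L,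
        (torusChar Q.1 (fun _ : Fin 1 => (((x 0).1 : ℕ) : ZMod (2 * M)) - (((x 1).1 : ℕ) : ZMod (2 * M))) *
          torusChar Q.2 ((x 0).2 - (x 1).2)) • (fun Q => f (-Q)) Q‖ else 0 := by
  have h := norm_planeWaveSum_le_pairTransfer_of_conserving_perm hβ σ (Equiv.swap 1 2) (![0, 1, 0, 1]) (by decide) K κ f
    (fun k => by rw [hker k]; simp [Equiv.swap_apply_of_ne_of_ne]) x
  simpa [Equiv.swap_apply_of_ne_of_ne] using h

/-- **String `(+,−,−,+)`** (creators on legs `0,3`): conservation `k̄₀ + k̄₃ = k̄₁ + k̄₂`, transfer `f(k̄₀ + k̄₃)` ⟹ (T2′)'s pairing-`{0,3}{1,2}` majorant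
`[x 3 = x 0 ∧ x 2 = x 1]·(‖κ‖(2M·L²)²)·‖Σ_Q χ̄_Q(x̄₀ − x̄₁)•f(−Q)‖`. [cite: BenfattoGiulianiMastropietro2006, §3 (3.2)–(3.6)] -/
theorem norm_planeWaveSum_le_pairTransfer_of_conserving_cycle132 {β : ℝ} (hβ : β ≠ 0) (σ : Fin 4 → Fin 2)
    (K : (Fin 4 → FreqMomentum L M) → ℂ) (κ : ℂ) (f : TorusSite 1 (2 * M) × TorusSite 2 L → ℂ)
    (hker : ∀ k : Fin 4 → FreqMomentum L M, K k = κ * (if ((fun _ : Fin 1 => (((k 0).1 : ℕ) : ZMod (2 * M))), (k 0).2) + ((fun _ : Fin 1 => (((k 3).1 : ℕ) : ZMod (2 * M))), (k 3).2) = (((fun _ : Fin 1 => (((k 1).1 : ℕ) : ZMod (2 * M))), (k 1).2) : TorusSite 1 (2 * M) × TorusSite 2 L) + ((fun _ : Fin 1 => (((k 2).1 : ℕ) : ZMod (2 * M))), (k 2).2) then f (((fun _ : Fin 1 => (((k 0).1 : ℕ) : ZMod (2 * M))), (k 0).2) + ((fun _ : Fin 1 => (((k 3).1 : ℕ) : ZMod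 (2 * M))), (k 3).2)) else 0))
    (x : Fin 4 → SpaceTimeIdx L M) :
    ‖∑ k : Fin 4 → FreqMomentum L M,
        (∏ i, trivialMultiplier L M ((fun i : Fin 4 => ((((0 : Fin 1), σ i) : Fin 1 × Fin 2), (![0, 1, 1, 0] : Fin 4 → Fin 2) i)) i).1.1 (k i) *
          hubbardPlaneWave L M β ((fun i : Fin 4 => ((((0 : Fin 1), σ i) : Fin 1 × Fin 2), (![0, 1, 1, 0] : Fin 4 → Fin 2) i)) i).2 (k i) (x i)) * K k‖ ≤
      if x 3 = x 0 ∧ x 2 = x 1 then (‖κ‖ * ((((2 * M : ℕ) : ℝ) * (L : ℝ) ^ 2) ^ 2)) * ‖∑ Q : TorusSite 1 (2 * M) × TorusSite 2 L,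
        (torusChar Q.1 (fun _ : Fin 1 => (((x 0).1 : ℕ) : ZMod (2 * M)) - (((x 1).1 : ℕ) : ZMod (2 * M))) *
          torusChar Q.2 ((x 0).2 - (x 1).2)) • (fun Q => f (-Q)) Q‖ else 0 := by
  have h := norm_planeWaveSum_le_pairTransfer_of_conserving_perm hβ σ (Equiv.swap 1 2 * Equiv.swap 1 3) (![0, 1, 1, 0]) (by decide) K κ f
    (fun k => by rw [hker k]; simp [Equiv.Perm.mul_apply, Equiv.swap_apply_of_ne_of_ne]) x
  simpa [Equiv.Perm.mul_apply, Equiv.swap_apply_of_ne_of_ne] using h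

end Summit.HubbardSuperconductivity.HubbardSuperconductivity.Theorems.TorusFourierL2

end
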